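/-
Copyright: H21 programme, solo seat `solo-RiemannHypothesis-informed` (session 5).
-/
import Summits.RiemannHypothesis.RiemannHypothesis.Theorems.SoloInformedBumpDipole
import Summits.RiemannHypothesis.RiemannHypothesis.Theorems.SoloInformedDodging

/-!
# Derivative norms of iterated dodges (solo-informed, bookkeeping for T25)

For a smooth compactly supported `u : ℝ → ℂ` and the dodge `D_τ u = −u″ − τ² u`
(`weilDodge`, `SoloInformedDodging`), iterated over a list `L` (`weilDodges L u`):

* `iteratedDeriv_weilDodge`: `(D_τ u)^{(j)} = −u^{(j+2)} − τ² u^{(j)}`;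
* `integral_norm_iteratedDeriv_weilDodge_le`: `‖(D_τ u)^{(j)}‖₁ ≤ ‖u^{(j+2)}‖₁ + ‖τ‖² ‖u^{(j)}‖₁`;
* `integral_norm_iteratedDeriv_weilDodges_le`: if `‖u^{(i)}‖₁ ≤ N_u` for all `i ≤ m`, then
  `‖(D_L u)^{(j)}‖₁ ≤ (∏_{τ ∈ L} (1 + ‖τ‖²)) · N_u` whenever `j + 2|L| ≤ m`;
* `weilDodges_odd`: iterated dodging preserves oddness;
* `bumpNormSum ψ m = Σ_{i ≤ m} ‖ψ^{(i)}‖₁` and, for the displaced-bump dipole `h_c = bumpDipole ψ c`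
  (`SoloInformedBumpDipole`), the bound `‖(D_L h_c)^{(j)}‖₁ ≤ 2 (∏_{τ ∈ L} (1 + ‖τ‖²)) bumpNormSum ψ m`,
  UNIFORM in the displacement `c` (`integral_norm_iteratedDeriv_weilDodges_bumpDipole_le`).

Pure calculus; no input about `ζ`.  Used by `SoloInformedClusterDodge` (bounded-cluster
visibility, T25).
-/

open MeasureTheory Complex Set Filter Topology Literature.NumberTheory.LFunctions
open scoped ContDiff

namespace Summit.RiemannHypothesis.RiemannHypothesis.Theorems

/-! ## One dodge -/

/-- `(D_τ u)^{(j)} = −u^{(j+2)} − τ² u^{(j)}` for smooth `u`. -/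
theorem iteratedDeriv_weilDodge {u : ℝ → ℂ} (hu : ContDiff ℝ ∞ u) (τ : ℂ) (j : ℕ) :
    iteratedDeriv j (weilDodge τ u) =
      fun t ↦ -iteratedDeriv (j + 2) u t - τ ^ 2 * iteratedDeriv j u t := by
  have h2 : weilDodge τ u = fun t ↦ -iteratedDeriv 2 u t - τ ^ 2 * u t := by
    funext t; simp [weilDodge, iteratedDeriv_succ]
  have hu2 : ContDiff ℝ ∞ (iteratedDeriv 2 u) := by
    rw [iteratedDeriv_eq_iterate]; exact hu.iterate_deriv 2
  funext t
  have hf : ContDiffAt ℝ j (fun t ↦ -iteratedDeriv 2 u t) t :=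
    ((hu2.neg).of_le (by exact_mod_cast le_top)).contDiffAt
  have hg : ContDiffAt ℝ j (fun t ↦ τ ^ 2 * u t) t :=
    ((contDiff_const.mul hu).of_le (by exact_mod_cast le_top)).contDiffAt
  have huj : ContDiffAt ℝ j u t := (hu.of_le (by exact_mod_cast le_top)).contDiffAt
  rw [h2, iteratedDeriv_fun_sub hf hg, iteratedDeriv_fun_neg, iteratedDeriv_const_mul _ huj]
  simp only [iteratedDeriv_eq_iterate]
  rw [Function.iterate_add_apply]

/-- `‖(D_τ u)^{(j)}‖₁ ≤ ‖u^{(j+2)}‖₁ + ‖τ‖² ‖u^{(j)}‖₁` for a test function `u`. -/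
theorem integral_norm_iteratedDeriv_weilDodge_le {u : ℝ → ℂ} (hu : IsWeilTest u) (τ : ℂ)
    (j : ℕ) :
    ∫ t, ‖iteratedDeriv j (weilDodge τ u) t‖ ≤
      (∫ t, ‖iteratedDeriv (j + 2) u t‖) + ‖τ‖ ^ 2 * ∫ t, ‖iteratedDeriv j u t‖ := by
  have hint : ∀ k, Integrable (iteratedDeriv k u) := fun k ↦
    (hu.1.continuous_iteratedDeriv k (by exact_mod_cast le_top)).integrable_of_hasCompactSupport
      (GuthMaynardFourier.hasCompactSupport_iteratedDeriv hu.2 k)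
  rw [iteratedDeriv_weilDodge hu.1 τ j]
  have hA : Integrable fun t ↦ ‖iteratedDeriv (j + 2) u t‖ := (hint (j + 2)).norm
  have hB : Integrable fun t ↦ ‖τ‖ ^ 2 * ‖iteratedDeriv j u t‖ := (hint j).norm.const_mul _
  calc ∫ t, ‖-iteratedDeriv (j + 2) u t - τ ^ 2 * iteratedDeriv j u t‖
      ≤ ∫ t, (‖iteratedDeriv (j + 2) u t‖ + ‖τ‖ ^ 2 * ‖iteratedDeriv j u t‖) := by
        refine integral_mono_of_nonneg (Eventually.of_forall fun t ↦ norm_nonneg _) (hA.add hB)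
          (Eventually.of_forall fun t ↦ ?_)
        calc ‖-iteratedDeriv (j + 2) u t - τ ^ 2 * iteratedDeriv j u t‖
            ≤ ‖-iteratedDeriv (j + 2) u t‖ + ‖τ ^ 2 * iteratedDeriv j u t‖ := norm_sub_le _ _
          _ = ‖iteratedDeriv (j + 2) u t‖ + ‖τ‖ ^ 2 * ‖iteratedDeriv j u t‖ := by
              rw [norm_neg, norm_mul, norm_pow]
    _ = (∫ t, ‖iteratedDeriv (j + 2) u t‖) + ‖τ‖ ^ 2 * ∫ t, ‖iteratedDeriv j u t‖ := by
        rw [integral_add hA hB, integral_const_mul]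

/-! ## Iterated dodges -/

/-- Iterated dodging preserves oddness (so iterated dodges of dipoles are dipoles). -/
theorem weilDodges_odd {h : ℝ → ℂ} (hodd : ∀ t, h (-t) = -h t) :
    ∀ (L : List ℂ) (t : ℝ), weilDodges L h (-t) = -weilDodges L h t
  | [], t => by simpa [weilDodges] using hodd t
  | τ :: L, t => weilDodge_odd (weilDodges_odd hodd L) τ t

/-- **Norm bookkeeping for iterated dodges.**  If `‖u^{(i)}‖₁ ≤ N_u` for all `i ≤ m`, then
`‖(D_L u)^{(j)}‖₁ ≤ (∏_{τ ∈ L} (1 + ‖τ‖²)) · N_u` whenever `j + 2|L| ≤ m`. -/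
theorem integral_norm_iteratedDeriv_weilDodges_le {u : ℝ → ℂ} (hu : IsWeilTest u) {m : ℕ}
    {Nu : ℝ} (hN : ∀ i ≤ m, ∫ t, ‖iteratedDeriv i u t‖ ≤ Nu) :
    ∀ (L : List ℂ) (j : ℕ), j + 2 * L.length ≤ m →
      ∫ t, ‖iteratedDeriv j (weilDodges L u) t‖ ≤ (L.map fun τ ↦ 1 + ‖τ‖ ^ 2).prod * Nu
  | [], j, hj => by simpa [weilDodges] using hN j (by simpa using hj)
  | τ :: L, j, hj => by
      have hW : IsWeilTest (weilDodges L u) := isWeilTest_weilDodges hu L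
      have hlen : (τ :: L).length = L.length + 1 := rfl
      have h1 := integral_norm_iteratedDeriv_weilDodges_le hu hN L (j + 2)
        (by rw [hlen] at hj; omega)
      have h2 := integral_norm_iteratedDeriv_weilDodges_le hu hN L j (by rw [hlen] at hj; omega)
      calc ∫ t, ‖iteratedDeriv j (weilDodges (τ :: L) u) t‖
          = ∫ t, ‖iteratedDeriv j (weilDodge τ (weilDodges L u)) t‖ := rfl
        _ ≤ (∫ t, ‖iteratedDeriv (j + 2) (weilDodges L u) t‖)
              + ‖τ‖ ^ 2 * ∫ t, ‖iteratedDeriv j (weilDodges L u) t‖ :=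
            integral_norm_iteratedDeriv_weilDodge_le hW τ j
        _ ≤ (L.map fun τ ↦ 1 + ‖τ‖ ^ 2).prod * Nu
              + ‖τ‖ ^ 2 * ((L.map fun τ ↦ 1 + ‖τ‖ ^ 2).prod * Nu) :=
            add_le_add h1 (mul_le_mul_of_nonneg_left h2 (sq_nonneg _))
        _ = ((τ :: L).map fun τ ↦ 1 + ‖τ‖ ^ 2).prod * Nu := by
            simp only [List.map_cons, List.prod_cons]; ring

/-! ## The displaced-bump dipole: `c`-independent norms of all its dodges -/

/-- `B_m(ψ) = Σ_{i ≤ m} ‖ψ^{(i)}‖₁`, the sum of the first `m + 1` derivative `L¹` norms of a bump. -/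
noncomputable def bumpNormSum (ψ : ℝ → ℝ) (m : ℕ) : ℝ :=
  ∑ i ∈ Finset.range (m + 1), ∫ s, |iteratedDeriv i ψ s|

/-- `0 ≤ B_m(ψ)`. -/
theorem bumpNormSum_nonneg (ψ : ℝ → ℝ) (m : ℕ) : 0 ≤ bumpNormSum ψ m :=
  Finset.sum_nonneg fun _ _ ↦ integral_nonneg fun _ ↦ abs_nonneg _

/-- Each summand is dominated by the sum: `‖ψ^{(i)}‖₁ ≤ B_m(ψ)` for `i ≤ m`. -/
theorem integral_abs_iteratedDeriv_le_bumpNormSum (ψ : ℝ → ℝ) {i m : ℕ} (hi : i ≤ m) :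
    ∫ s, |iteratedDeriv i ψ s| ≤ bumpNormSum ψ m := by
  unfold bumpNormSum
  exact Finset.single_le_sum (f := fun i ↦ ∫ s, |iteratedDeriv i ψ s|)
    (fun _ _ ↦ integral_nonneg fun _ ↦ abs_nonneg _) (Finset.mem_range.mpr (by omega))

variable {ψ : ℝ → ℝ}

/-- **Uniform derivative norms of dodged bump dipoles.**  For `j + 2|L| ≤ m`:
`‖(D_L h_c)^{(j)}‖₁ ≤ (∏_{τ ∈ L} (1 + ‖τ‖²)) · 2B_m(ψ)`, uniformly in the displacement `c ≥ 0`. -/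
theorem integral_norm_iteratedDeriv_weilDodges_bumpDipole_le (hψ : ContDiff ℝ ∞ ψ)
    (hsupp : tsupport ψ ⊆ Icc (-1) 1) {c : ℝ} (hc : 0 ≤ c) (m : ℕ) (L : List ℂ) {j : ℕ}
    (hj : j + 2 * L.length ≤ m) :
    ∫ t, ‖iteratedDeriv j (weilDodges L (bumpDipole ψ c)) t‖ ≤
      (L.map fun τ ↦ 1 + ‖τ‖ ^ 2).prod * (2 * bumpNormSum ψ m) := by
  refine integral_norm_iteratedDeriv_weilDodges_le (isWeilTest_bumpDipole hψ hsupp hc) ?_ L j hj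
  intro i hi
  exact (integral_norm_iteratedDeriv_bumpDipole_le hψ hsupp c i).trans
    (mul_le_mul_of_nonneg_left (integral_abs_iteratedDeriv_le_bumpNormSum ψ hi) (by norm_num))

end Summit.RiemannHypothesis.RiemannHypothesis.Theorems
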